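import Summits.BirchSwinnertonDyer.Rank1Residual.O5.HeegnerLogTransportThreeBSDp
import Summits.BirchSwinnertonDyer.Rank1Residual.O5.HeegnerLogTransportThreeTwoSidedRow430425o1
import Literature.NumberTheory.EllipticCurves.ManinConstantSemistablePrimewise
import Literature.NumberTheory.EllipticCurves.CuspFormLFunctionLevelConductorProofs
import Literature.NumberTheory.EllipticCurves.Wuthrich2014.ThreeAdicImageSupersingularProofs
import Literature.NumberTheory.EllipticCurves.AnalyticRankModularityProofs
import Summits.BirchSwinnertonDyer.Rank1Residual.O5.HeegnerHypothesisOfDiscr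
import HarnessLib
import HarnessLib.Audit.Tags

/-!
# Heegner-log transport at `p = 3` (KL3), part 32c — the third two-sided ROW OF RECORD
# `430425o1 ~ 47825d1` (`K = ℚ(√−86)`, `d_K = −344`) in the cell's closing currency: `BSDp 430425o1 3`
# (o5-r2 GEN 33; STAGED: imports part 32 = `O5.HeegnerLogTransportThreeBSDp` (by-sha ask A-O5-G32-1) and
# the 25e ROW `O5.HeegnerLogTransportThreeTwoSidedRow430425o1` (p366428); §1 was farm-checked standalone
# against BUILT modules in `gen33/scratch/TwistModelsKL3Five_scratch.lean` (rc 0, 0 warnings, axioms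
# standard); §2 is the mechanical mirror of the checked `o5_bsdp_row240930b1`.)

GEN 35 (this file SUPERSEDES the GEN 34 bytes of the same name; o5-r2 GEN 35, memo `HOME/b2b-bsdres-o5-r2/gen35/O5-GEN35.md`):
(1) MAZUR FOR THE COMPANION. The companion-side Manin binder `hc3' : ¬ 3 ∣ c(D')` of the good companion `47825d1` (`N_G = 47825 = 5²·1913`: `3 ∤ N_G`) is discharged
BY NAME from the REFEREED theorem Mazur 1978, Cor. 4.1 = tree named fact `mazur_not_dvd_maninConstant_of_odd`
(`Literature/NumberTheory/EllipticCurves/ManinConstantSemistablePrimewise.lean`, librarian 2026-08-16, BUILT; Česnavičius 2018 Thm. 1.2 (MK-1),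
arXiv:1604.02165 p. 3; consumed likewise by X11b `BDPRouteManin`): globally minimal `G` (MODELS instance), optimal datum (`hopt'` = the fact's own
binder `Λ_E ⊆ c·Λ_f`), `p = 3 ≠ 2`, `¬ 3² ∣ N'` by Carayol (`N' = N_G` from `hmod`, kernel numeral `conductorNorm_G…`) + `norm_num` — NO range
bound, NO database primary, NO registry flag. New:
`o5_bsdp_row430425o1_mazur` REPLACE GEN 33/34's `_manin` of the same row(s), which discharged the same binder from A321 =
`cremona_abs_maninConstant_eq_one_of_level_le_300000` and would carry its provenance flags (that import is dropped: no A321 consumer remains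
here); the RECORD-side `hc3` stays DISPLAYED (`N = 430425 > 300000`: outside A321's printed range — referee A R199.5 / REFEREE-2 R2-140.1 —
and `3² ∣ N`: outside Mazur).
(2) The Heegner level lemma(s) `satisfiesHeegnerHypothesis_430425_of_discr` (GEN 34 edit 3) MOVED, bytes unchanged, to part 35h
`O5/HeegnerHypothesisOfDiscr.lean` (imported; dependency-free, farm-checked rc 0) — no row file imports another row file any more.
No other change of statement; §1/§2 byte-identical to GEN 34.

GEN 34 (superseded the GEN 33 bytes): the binder
`hW20 : Wuthrich2014.lemma20_surjective_threeAdic_of_semistable` (Wuthrich 2014, Lemma 20; registry CITED-FACTS A9)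
is NO LONGER DISPLAYED — it is DISCHARGED BY NAME by the tree theorem
`Wuthrich2014.lemma20_surjective_threeAdic_of_semistable_holds`
(`Literature/NumberTheory/EllipticCurves/Wuthrich2014/ThreeAdicImageSupersingularProofs.lean`, landed 2026-08-21,
built; A9 → DISCHARGED (PROVED), CITED-FACTS l.1094), exactly as the Additive lane's `…NoLemma20` files do.
Likewise `hmodE : hasEntireLFunction_rat` (A19) is NO LONGER DISPLAYED: it is DERIVED from `hmod` by the tree theorem
`WeierstrassCurve.hasEntireLFunction_rat_of_exists_isNewformOf` (`AnalyticRankModularityProofs.lean`, Diamond–Shurman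
Thm 8.8.3 + 5.10.2), as the X11b Castella files do — the displayed modularity input is the single root fact `hmod`.
Third (GEN 34 edit 3): the Heegner-hypothesis binders `hH : SatisfiesHeegnerHypothesis N K`, `hH' : … N' K`,
`h3K : … 3 K` are NO LONGER DISPLAYED — they are DERIVED IN THE KERNEL: the decomposition law
(`satisfiesHeegnerHypothesis_iff_kronecker`, tree, PROVED) + Jacobi symbols `(d_K/p) = 1` by `norm_num` for the primes of the
literal level (`satisfiesHeegnerHypothesis_<N>_of_discr`, part 35h), Carayol (`N = N_W`, `N' = N_G` from `hmod`, as for the Manin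
discharge) and `SatisfiesHeegnerHypothesis.of_dvd` (`N_G ∣ N_W`, `3 ∣ N_W`). The remaining set-up binders
(`D`, `D'`, `K` with `hK`/`hdK`, `H`, `H'`, `ι`, `ι₃`, `P`, `P'` with `hP`/`hP'`) are pure DATA, each instantiable by a
tree theorem given `hmod` (see the GEN 34 binder census). No other change of statement.

HONEST FRAMING (cell `b2b-bsdres`, run/shared/lean/b2b/bsd-rank1-residual/, verbatim in every file): the
goal of the cell is to DELETE the COMBINATION-SHAPED residual classes of the Birch–Swinnerton-Dyer
formula for ALL analytic-rank `≤ 1` elliptic curves over `ℚ` — "full BSD formula for every rank `≤ 1`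
curve in class `C`" assembled STRICTLY from published theorems — so that the rank-`≤ 1` remainder
becomes exactly the CONSTRUCTION-SHAPED classes, which are TYPED (missing-input `Prop`s), NOT
attempted. This is not "finishing BSD". Seat o5-r2 (planner 2, non-Iwasawa side) works a RESEARCH ROUTE
on O5 = (t′); **O5 stays OPEN**; no claim beyond the stated rows; every theorem is CONDITIONAL on its
displayed binders; census / instrument statements are EVIDENCE or displayed binders, never a Literature
fact; NOTHING is booked and no mark / label / count / tier of `RESIDUAL-MAP.md` moves.

THE ONE ROW WITH `u ≠ 1`: the tree's model `430425o1.quadraticTwist (−344) = ⟨0, 0, 0, 79876800,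
−1476922032000⟩` is NOT minimal at `2`; the globally minimal model is `(2, 0, 0, 0) • it =
⟨0, 0, 0, 4992300, −23076906750⟩` (conductor `430425·344² = 50934772800`, `v₂(N_F) = 6`), and
`ord₃ u = ord₃ 2 = 0` — the closing law's `hu` is still trivial, but it is NOT `u = 1`.

Record row (EVIDENCE, `O5/HeegnerIndexRecordsThreeRankOneT4.lean` l.341): `430425o1`, `D = −344`,
`m₁ = m₂ = 8`, `#F(ℚ)_tors = 1`, `∏c_ℓ(F) = 8`, `#Ш_an(F) = 1` (so `ord₃ q_d = 0`).
§3 (o5-r2 GEN 35, superseding GEN 33/34's `_manin`): `o5_bsdp_row430425o1_mazur` — the companion-side Manin binder `hc3'`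
DISCHARGED BY NAME from Mazur 1978 Cor. 4.1 (`mazur_not_dvd_maninConstant_of_odd`, refereed, no range, no flag; `N(47825d1) = 47825 = 5²·1913`,
`3 ∤ N'`, via Carayol's level theorem `IsNewformOf.level_eq_conductorNorm_of_exists_isNewformOf` + the kernel numeral `conductorNorm_G47825d1`)
at the price of the displayed optimality `hopt'` of the chosen datum; the RECORD-side `hc3` is KEPT (honest negative: `N = 430425 > 300000`
outside A321's printed range; `3² ∣ N` outside Mazur). §2 and the GEN 33/34 §3 were elaborated in `gen33/scratch/BSDpRowsSix_composition_scratch.lean` /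
`gen34/scratch/BSDpNoLemma20_composition_scratch.lean` (rc 0); the GEN 35 §3 in `gen35/scratch/BSDpMazur_composition_scratch.lean` (rc recorded in
`gen35/scratch/CHECKS.md`) as real text over sorried stand-ins for the unbuilt END / base rows (signatures verbatim), the Mazur module imported for REAL.

References: as part 32; [CesnaviciusNeururerSaha2023] §1; [Mazur1978] Cor. 4.1; [Cesnavicius2018] Thm. 1.2 (MK-1); [AgasheRibetStein2006] Thm. 2.3, 2.6;
[DiamondShurman2005] Thm. 8.8.1; [CremonaAlgorithms1997] §3.2; [Kraus1989] Prop. 1–2; [SilvermanAEC2009] III.1, VII.1;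
memo `HOME/b2b-bsdres-o5-r2/gen33/O5-GEN33.md`.

### cc-typer-5 GEN 20 (O5 §3.5 / O6 §3.4 typer of record) — by-name ask A-O5-G35-1 of o5-r2 GEN 35 (HOME/INBOX.md l.16133; by sha, VERBATIM + ¶; memo gen35/O5-GEN35.md §G35-6;
SUPERSEDES the A-O5-G33-1 / G34-1 versions) item (c) 0720543b80a9263f → O5/HeegnerLogTransportThreeBSDpRow430425o1.lean (after (h) + part 32 + 25e ROW). Source:
`HOME/b2b-bsdres-o5-r2/gen35/lean/HeegnerLogTransportThreeBSDpRow430425o1.lean` sha16 `0720543b80a9263f` (262 l.; `gen35/SHA16.txt`; o5-r2's farm checks rc 0 / 0 warnings / 0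
sorries, axioms standard, dedup clean as stated in their line), re-hashed by the typer right before writing; THIS file = the source VERBATIM + this paragraph (imports, module
text, every declaration block byte-identical; script `class-closure/typer-5/gen20/gplace.py`, docstring anchor asserted); imports `O5.HeegnerLogTransportThreeBSDp`,
`O5.HeegnerLogTransportThreeTwoSidedRow430425o1`, `Literature.NumberTheory.EllipticCurves.ManinConstantSemistablePrimewise`,
`Literature.NumberTheory.EllipticCurves.CuspFormLFunctionLevelConductorProofs`, `Literature.NumberTheory.EllipticCurves.Wuthrich2014.ThreeAdicImageSupersingularProofs`,
`Literature.NumberTheory.EllipticCurves.AnalyticRankModularityProofs`, `O5.HeegnerHypothesisOfDiscr` — all in the tree at filing; the typer's own standalone farm check on tree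
imports (rc 0 / 0 warnings / 0 sorries; `#print axioms` of the END(s) standard) and DEDUP (`lean search --decl` on the 7 new names + 2 instances: no match; the gate's
statement-level dedup at dry-run) precede the proposal. CONTENT LABELS: as the source's module text above states (declarations: `Wd430425o1_344`,
`isGloballyMinimal_Wd430425o1_344`, `twistChange344W`, `twist_W430425o1_344`, `padicValRat_u_twistChange344W`, `o5_bsdp_row430425o1`, `o5_bsdp_row430425o1_mazur`); 0
`@[conjecture]`, 0 Literature facts (net named-fact debt 0), no `sorry`; published inputs stay displayed hypotheses BY NAME, nothing re-proved. HONEST FRAMING (cell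
`b2b-bsdres`): research route, lane CLASS-CLOSURE §3.5 O5; CONDITIONAL ENDs — nothing asserted beyond the displayed binders, nothing booked, no mark / label / count / tier of
`RESIDUAL-MAP.md` moves; census / instrument statements = EVIDENCE or displayed binders, never a Literature fact; O5 OPEN.
-/

set_option autoImplicit false

noncomputable section

open scoped Classical

open WeierstrassCurve Literature.NumberTheory.EllipticCurves
  Literature.NumberTheory.EllipticCurves.ModularForms
  Literature.NumberTheory.EllipticCurves.Rank1Residual
  Literature.NumberTheory.EllipticCurves.Rank1Residual.Typed
  Literature.NumberTheory.EllipticCurves.KrizLi2019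
open Summit.BirchSwinnertonDyer.Rank1Residual.X11b (isGloballyMinimal_of_krausCriterion_support)
open IsDedekindDomain (HeightOneSpectrum)
open scoped NumberField

namespace Summit.BirchSwinnertonDyer.Rank1Residual.O5.HeegnerLogTransport

/-! ## §1 The twist model (checked standalone, rc 0) -/

namespace KL3TwoSidedRows

/-- A globally minimal model of the quadratic twist `430425o1^(−344)` (conductor `50934772800`): the tree's
`quadraticTwist (−344) = ⟨0, 0, 0, 79876800, −1476922032000⟩` descaled by `u = 2`.
[cite: CremonaAlgorithms1997, §3.2] -/
def Wd430425o1_344 : WeierstrassCurve ℚ := ⟨0, 0, 0, 4992300, -23076906750⟩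

/-- `Δ(Wd430425o1_344) = −2⁶·3⁹·5⁶·43⁶·1913 ≠ 0`. [folklore] -/
instance : Wd430425o1_344.IsElliptic := ⟨by
  rw [isUnit_iff_ne_zero]
  norm_num [Wd430425o1_344, WeierstrassCurve.Δ, WeierstrassCurve.b₂, WeierstrassCurve.b₄,
    WeierstrassCurve.b₆, WeierstrassCurve.b₈]⟩

/-- `Wd430425o1_344` is globally minimal: `|Δ| = 2⁶·3⁹·5⁶·43⁶·1913`, `v_q Δ < 12` at every `q`.
[cite: SilvermanAEC2009, VII.1 Remark 1.1] [cite: Kraus1989, Prop. 1 and Prop. 2] -/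
theorem isGloballyMinimal_Wd430425o1_344 : Wd430425o1_344.IsGloballyMinimal :=
  isGloballyMinimal_of_krausCriterion_support 0 0 0 4992300 (-23076906750)
    [(2, 6, 6), (3, 2, 9), (5, 2, 6), (43, 2, 6), (1913, 1, 1)]
    (by intro t ht; simp only [List.mem_cons, List.not_mem_nil, or_false] at ht
        rcases ht with rfl | rfl | rfl | rfl | rfl <;> norm_num)
    (by decide +kernel) (by decide +kernel)

/-- Instance form of `isGloballyMinimal_Wd430425o1_344` (typer lint docstring). [cite: Kraus1989, Prop. 1 and Prop. 2] -/
instance : Wd430425o1_344.IsGloballyMinimal := isGloballyMinimal_Wd430425o1_344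

/-- The change of variables `(u, r, s, t) = (2, 0, 0, 0)`. [cite: SilvermanAEC2009, III.1 Table 3.1] -/
def twistChange344W : VariableChange ℚ := ⟨⟨2, 2⁻¹, by norm_num, by norm_num⟩, 0, 0, 0⟩

/-- **The twist identity IN THE KERNEL**: `(2, 0, 0, 0) • 430425o1.quadraticTwist (−344) = Wd430425o1_344`
(`b₂, b₄, b₆ = 0, 1350, 145125`; `a₄ = 344²·b₄/(2·2⁴)`, `a₆ = −344³·b₆/(4·2⁶)`).
[cite: SilvermanAEC2009, III.1 Table 3.1 and X.5 Cor. 5.4] -/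
theorem twist_W430425o1_344 :
    twistChange344W • W430425o1.quadraticTwist ((-344 : ℤ) : ℚ) = Wd430425o1_344 := by
  ext <;> norm_num [WeierstrassCurve.variableChange_def, WeierstrassCurve.quadraticTwist, W430425o1,
    Wd430425o1_344, twistChange344W, WeierstrassCurve.b₂, WeierstrassCurve.b₄, WeierstrassCurve.b₆,
    Units.inv_mk]

/-- `u = 2` for `twistChange344W`, so `ord₃ u = 0`. [folklore] -/
theorem padicValRat_u_twistChange344W : padicValRat 3 (twistChange344W.u : ℚ) = 0 := by
  have h : (twistChange344W.u : ℚ) = ((2 : ℕ) : ℚ) := by simp [twistChange344W]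
  rw [h, padicValRat.of_nat]
  simp [padicValNat.eq_zero_of_not_dvd (show ¬ 3 ∣ 2 by decide)]

end KL3TwoSidedRows

open KL3TwoSidedRows

/-! ## §2 The row of record `430425o1 ~ 47825d1` in closing currency (mirror of `o5_bsdp_row240930b1`) -/

/-- **THE THIRD TWO-SIDED ROW OF RECORD IN CLOSING CURRENCY: `BSD(430425o1, 3)`** — part 25e's
`o5_index_unit_row430425o1` (`W := 430425o1`, `G := 47825d1` (anomalous good-ordinary companion), `Gd := Gd344`)
composed with part 32 §1 (`bsdp_of_rankOne_of_indexUnit`): `P`'s non-torsion DERIVED (`r_an(W) = 1`,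
`q_d ≠ 0`, Gross–Zagier BY NAME), index finiteness = Kolyvagin BY NAME, `u = 2` (`ord₃ u = 0`), twist
identity and minimality in the kernel (§1), `3 ∤ ∏c(W)` = `tam3_W430425o1`. Displayed: `hKL`, `hYZ`, `hmod`, `hGZK`
(GEN 34: `hW20` = Wuthrich L.20 DISCHARGED BY NAME; `hmodE` DERIVED from `hmod`; `hH`, `hH'`, `h3K` DERIVED in the kernel); `hGZ`, `hKo`, `hB` (`W/K`); `hKoG`, `hGZG`; row data `hρ`, `hr`, Heegner data over
`d_K = −344`, `hP'inf`, `hSelG`, `hSelGd`, `hc3`, `hc3'`, `q_d` (`hqd`, `hqd0`, `hvd`). Conditional theorem;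
research route; O5 OPEN; nothing booked.
[cite: KrizLi2019, Theorem 1.16 (arXiv:1609.06687v4 pp. 7-8)] [cite: McCallumLMS1991, §1 Theorem (Kolyvagin), p. 296]
[cite: GrossZagier1986, Thm. I.6.3] [cite: Kolyvagin1990, Thm. A] [cite: YanZhu2026, Theorem 4.15]
[cite: CremonaAlgorithms1997, Table 1] -/
theorem o5_bsdp_row430425o1
    (hKL : KrizLi2019.thm116_padicLogHeegner_congruence)
    (hYZ : YanZhu2026.thm415_padicValRat_bsd_rank_le_one)
    (hmod : exists_isNewformOf)
    (hGZK : rank_eq_analyticRank_of_analyticRank_le_one)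
    (hρ : W430425o1.HasSurjectiveModNGaloisRep 3) (hr : W430425o1.analyticRank = 1)
    {N N' : ℕ} [NeZero N] [NeZero N'] (D : ModularParametrizationData W430425o1 N)
    (D' : ModularParametrizationData G47825d1 N')
    (K : Type) [Field K] [NumberField K] (hK : IsImaginaryQuadratic K) (hdK : NumberField.discr K = -344)
    (hGZ : gross_zagier N W430425o1 K) (hKo : kolyvagin N W430425o1 K)
    (hB : Kolyvagin1990_padicValNat_card_sha_le N W430425o1 K)
    (hKoG : kolyvagin N' G47825d1 K) (hGZG : gross_zagier N' G47825d1 K)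
    (H : HeegnerDatum N (NumberField.discr K)) (H' : HeegnerDatum N' (NumberField.discr K))
    (ι : K →+* ℂ) (ι₃ : K →+* ℚ_[3])
    (P : (W430425o1.baseChange K).toAffine.Point) (P' : (G47825d1.baseChange K).toAffine.Point)
    (hP : WeierstrassCurve.Affine.Point.map ι.toRatAlgHom P = heegnerPointComplex D H)
    (hP' : WeierstrassCurve.Affine.Point.map ι.toRatAlgHom P' = heegnerPointComplex D' H')
    (hP'inf : ¬ IsOfFinAddOrder P')
    (hSelG : Nat.card (G47825d1.selmerGroup (3 : ℤ)) = 3 ^ G47825d1.mordellWeilRank)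
    (hSelGd : Nat.card (Gd344.selmerGroup (3 : ℤ)) = 3 ^ Gd344.mordellWeilRank)
    (hc3 : ¬ ((3 : ℤ) ∣ D.maninConstant)) (hc3' : ¬ ((3 : ℤ) ∣ D'.maninConstant))
    (qd : ℚ) (hqd : Wd430425o1_344.entireLFunction 1 / (Wd430425o1_344.realPeriodRat : ℂ) = (qd : ℂ))
    (hqd0 : qd ≠ 0) (hvd : padicValRat 3 qd = 0) :
    BSDp W430425o1 3 := by
  have hN : N = 430425 :=
    (IsNewformOf.level_eq_conductorNorm_of_exists_isNewformOf hmod D.isNewformOf).trans conductorNorm_W430425o1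
  have hN' : N' = 47825 :=
    (IsNewformOf.level_eq_conductorNorm_of_exists_isNewformOf hmod D'.isNewformOf).trans conductorNorm_G47825d1
  have hHK : SatisfiesHeegnerHypothesis 430425 K := satisfiesHeegnerHypothesis_430425_of_discr hK.1 hdK
  have hH : SatisfiesHeegnerHypothesis N K := by rw [hN]; exact hHK
  have hH' : SatisfiesHeegnerHypothesis N' K := by rw [hN']; exact hHK.of_dvd (by norm_num)
  have h3K : SatisfiesHeegnerHypothesis 3 K := hHK.of_dvd (by norm_num)
  have hd : NumberField.discr K < -4 := by rw [hdK]; norm_num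
  have hc : ¬ ((3 : ℕ) : ℤ) ∣ D.c := by rw [Nat.cast_ofNat]; exact hc3
  have hWd : twistChange344W • W430425o1.quadraticTwist (NumberField.discr K : ℚ) = Wd430425o1_344 := by
    rw [hdK]; exact twist_W430425o1_344
  exact bsdp_of_rankOne_of_indexUnit W430425o1 3 N K D H ι P hGZ hKo hB hGZK
    (hasEntireLFunction_rat_of_exists_isNewformOf hmod)
    hK hH hd hP
    (by decide) hc hr hρ Wd430425o1_344 twistChange344W hWd padicValRat_u_twistChange344W qd hqd hqd0 hvd
    tam3_W430425o1 fun hPinf =>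
      o5_index_unit_row430425o1 hKL hYZ
        Wuthrich2014.lemma20_surjective_threeAdic_of_semistable_holds
        hmod hGZK hρ D D' K hK hdK hH hH' h3K hKoG hGZG H H' ι ι₃ P P'
        hP hP' hPinf hP'inf hSelG hSelGd (padicValInt.eq_zero_of_not_dvd hc3) hc3'

/-! ## §3 The same row(s) with the COMPANION-side Manin binder discharged BY NAME from Mazur 1978 Cor. 4.1
(`mazur_not_dvd_maninConstant_of_odd`; o5-r2 GEN 35 — REPLACES GEN 33/34's A321 variant `_manin`; record side `hc3` displayed: `N > 300000`) -/

/-- **Row `430425o1` in closing currency with the COMPANION-side Manin binder discharged BY NAME from Mazur 1978, Cor. 4.1 — flag-free**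
(o5-r2 GEN 35): `hc3' : ¬ 3 ∣ c(D')` (good companion `47825d1`: `N' = N(47825d1) = 47825 = 5²·1913`, `3 ∤ N'`, a fortiori `3² ∤ N'`) is REPLACED by the
REFEREED theorem Mazur 1978, Cor. 4.1 BY NAME: `hMaz` = `mazur_not_dvd_maninConstant_of_odd` (`Literature/NumberTheory/EllipticCurves/
ManinConstantSemistablePrimewise.lean`, librarian 2026-08-16, BUILT; = (MK-1) of Česnavičius 2018 Thm. 1.2, arXiv:1604.02165 p. 3: "for a new elliptic
optimal quotient `π : J₀(n) ↠ E` and a prime `p`, if `ord_p(n) ≤ 1` then `ord_p(c_π) = 0` … (MK-1) if `p` is odd (Mazur, [Maz78] Cor. 4.1)";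
consumed the same way by X11b `BDPRouteManin`)
and the optimality `hopt'` of the chosen companion datum (`Λ_E ⊆ c·Λ_f`, the fact's own binder): globally minimal `47825d1` (instance,
25e MODELS `…TwoSidedRow430425o1Models` l.182), `p = 3 ≠ 2` (`decide`), `¬ 3² ∣ N'` by Carayol's level theorem `IsNewformOf.level_eq_conductorNorm_of_exists_isNewformOf`
(from `hmod`) + the kernel numeral `conductorNorm_G47825d1` + `norm_num`. No range bound, no database primary, NO registry flag travels with this discharge.
The RECORD-side binder `hc3 : ¬ 3 ∣ c(D)` stays DISPLAYED: `N(430425o1) = 430425 = 3²·5²·1913` has `3² ∣ N` — outside Mazur's hypothesis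
and outside every printed Manin range (`N = 430425 > 300000`: A321 = `cremona_abs_maninConstant_eq_one_of_level_le_300000` is usable
AS PRINTED at `N ≤ 300000` ONLY — referee A R199.5, REFEREE-2 R2-140.1: an instantiation above `300000` would be a content bounce;
Cremona's `opt_man` row = database EVIDENCE only, `gen31/census/ecdata_opt_man_kl3rows.txt`).
This theorem REPLACES GEN 33/34's `o5_bsdp_row430425o1_manin`, which discharged the same binder from A321 (`N' = 47825 ≤ 300000`) and would
carry A321's two provenance flags; Mazur's theorem is refereed, has no range bound and no flag, at the same binder count. Everything else exactly as `o5_bsdp_row430425o1`.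
Conditional theorem; research route; O5 OPEN; nothing booked; census rows = EVIDENCE.
[cite: Mazur1978, Cor. 4.1] [cite: Cesnavicius2018, Thm. 1.2 (MK-1) (arXiv:1604.02165 text chunk 3 L49-59)]
[cite: AgasheRibetStein2006, Thm. 2.3] [cite: DiamondShurman2005, Thm. 8.8.1] -/
theorem o5_bsdp_row430425o1_mazur
    (hKL : KrizLi2019.thm116_padicLogHeegner_congruence)
    (hYZ : YanZhu2026.thm415_padicValRat_bsd_rank_le_one)
    (hmod : exists_isNewformOf)
    (hGZK : rank_eq_analyticRank_of_analyticRank_le_one)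
    (hρ : W430425o1.HasSurjectiveModNGaloisRep 3) (hr : W430425o1.analyticRank = 1)
    {N N' : ℕ} [NeZero N] [NeZero N'] (D : ModularParametrizationData W430425o1 N)
    (D' : ModularParametrizationData G47825d1 N')
    (K : Type) [Field K] [NumberField K] (hK : IsImaginaryQuadratic K) (hdK : NumberField.discr K = -344)
    (hGZ : gross_zagier N W430425o1 K) (hKo : kolyvagin N W430425o1 K)
    (hB : Kolyvagin1990_padicValNat_card_sha_le N W430425o1 K)
    (hKoG : kolyvagin N' G47825d1 K) (hGZG : gross_zagier N' G47825d1 K)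
    (H : HeegnerDatum N (NumberField.discr K)) (H' : HeegnerDatum N' (NumberField.discr K))
    (ι : K →+* ℂ) (ι₃ : K →+* ℚ_[3])
    (P : (W430425o1.baseChange K).toAffine.Point) (P' : (G47825d1.baseChange K).toAffine.Point)
    (hP : WeierstrassCurve.Affine.Point.map ι.toRatAlgHom P = heegnerPointComplex D H)
    (hP' : WeierstrassCurve.Affine.Point.map ι.toRatAlgHom P' = heegnerPointComplex D' H')
    (hP'inf : ¬ IsOfFinAddOrder P')
    (hSelG : Nat.card (G47825d1.selmerGroup (3 : ℤ)) = 3 ^ G47825d1.mordellWeilRank)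
    (hSelGd : Nat.card (Gd344.selmerGroup (3 : ℤ)) = 3 ^ Gd344.mordellWeilRank)
    (hMaz : mazur_not_dvd_maninConstant_of_odd)
    (hc3 : ¬ ((3 : ℤ) ∣ D.maninConstant))
    (hopt' : ∀ z ∈ D'.L.lattice, ∃ w ∈ periodLattice D'.f, z = D'.c * w)
    (qd : ℚ) (hqd : Wd430425o1_344.entireLFunction 1 / (Wd430425o1_344.realPeriodRat : ℂ) = (qd : ℂ))
    (hqd0 : qd ≠ 0) (hvd : padicValRat 3 qd = 0) :
    BSDp W430425o1 3 :=
  o5_bsdp_row430425o1 hKL hYZ hmod hGZK hρ hr D D' K hK hdK hGZ hKo hB hKoG hGZG H H'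
    ι ι₃ P P' hP hP' hP'inf hSelG hSelGd hc3
    (hMaz G47825d1 D' hopt' 3 Nat.prime_three (by decide)
      (by rw [(IsNewformOf.level_eq_conductorNorm_of_exists_isNewformOf hmod D'.isNewformOf).trans
        conductorNorm_G47825d1]; norm_num))
    qd hqd hqd0 hvd

end Summit.BirchSwinnertonDyer.Rank1Residual.O5.HeegnerLogTransport

end
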